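import Summits.KontsevichZagierPeriods.Zeta5Search.Certificates.ModRedLK3
import Summits.KontsevichZagierPeriods.Zeta5Search.Certificates.ModRedLK3End
import HarnessLib

/-!
# ζ(5) search — brown9 LEVEL 2: the relation (L-K3) for the triple sum `L(n,k₃)` (cell `pub-zeta5`, certifier `cert-2`)

HONEST FRAMING: systematic search; recurrence certificates; no irrationality claim unless certified.

Assembly of the ttrl2 lane's pure `k₃`-shift relation (L-K3) of fam-brown9's triple sum
`L(n,x) = Σ_{k=0}^{n} sL(n,x,k)`, `sL = (−1)^k C(n,k)·T(n;3n−x−k,3n−x)·T(n;3n−x−k,2n−k)` (`x = k₃`, `k = k₂`):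
`η₀(n,x)L(n,x) + η₁(n,x)L(n,x+1) + η₂(n,x)L(n,x+2) + η₃(n,x)L(n,x+3) = 0` for `n ≥ 2` and non-integral rational `x`
(`L_rel_K3`), from three kernel-certified pieces: the termwise identity (`LK3_termwise`, module reduction in coordinate
form) summed over `k = 0..n−2` (telescoping, `gL(n,x,0) = 0`), and the boundary term `Σ_j η_j[sL(n,x+j,n−1) + sL(n,x+j,n)]
+ gL(n,x,n−1) = 0` (`LK3_boundary`, from `EEnd_eval_zero`: module reduction at `k₂ = n−1` with the binomial relation).
Integral `x` (where the reduction multipliers may vanish) follow by polynomiality in a sequel, as for (R-NK).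
-/

noncomputable section

namespace Summit.KontsevichZagierPeriods.Zeta5Search.Certificates

namespace VIMInner.ModRed

open Finset Summit.KontsevichZagierPeriods.Zeta5Search.PolyReflect

/-- The triple sum `L(n,x) = Σ_{k=0}^{n} sL(n,x,k)` of fam-brown9's leading coefficient (`x = k₃`). -/
def Lsum (n : ℕ) (x : ℚ) : ℚ := ∑ k ∈ range (n + 1), sL n x k

/-- `gL(n,x,0) = 0`: the certificate numerators are divisible by `k`. -/
theorem gL_zero (n : ℕ) (x : ℚ) : gL n x 0 = 0 := by
  have h00 : ∀ w x : ℚ, ev3 PsiL00 w x 0 = 0 := by intro w x; rw [PsiL00, ev3_cons]; simp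
  have h01 : ∀ w x : ℚ, ev3 PsiL01 w x 0 = 0 := by intro w x; rw [PsiL01, ev3_cons]; simp
  have h10 : ∀ w x : ℚ, ev3 PsiL10 w x 0 = 0 := by intro w x; rw [PsiL10, ev3_cons]; simp
  have h11 : ∀ w x : ℚ, ev3 PsiL11 w x 0 = 0 := by intro w x; rw [PsiL11, ev3_cons]; simp
  unfold gL SL; simp [h00, h01, h10, h11]

/-- The termwise identity summed over `k = 0..m` (`n = m+2`): telescoping to `gL(n,x,m+1)`. -/
theorem LK3_telescoped (m : ℕ) (x : ℚ) (hx : ∀ z : ℤ, x ≠ z) :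
    ev2 etaL0 (m + 2) x * ∑ k ∈ range (m + 1), sL (m + 2) x k + ev2 etaL1 (m + 2) x * ∑ k ∈ range (m + 1), sL (m + 2) (x + 1) k
      + ev2 etaL2 (m + 2) x * ∑ k ∈ range (m + 1), sL (m + 2) (x + 2) k
      + ev2 etaL3 (m + 2) x * ∑ k ∈ range (m + 1), sL (m + 2) (x + 3) k = gL (m + 2) x (m + 1) := by
  have ht : ∀ k ∈ range (m + 1), ev2 etaL0 (m + 2) x * sL (m + 2) x k + ev2 etaL1 (m + 2) x * sL (m + 2) (x + 1) k
      + ev2 etaL2 (m + 2) x * sL (m + 2) (x + 2) k + ev2 etaL3 (m + 2) x * sL (m + 2) (x + 3) k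
      = gL (m + 2) x (k + 1) - gL (m + 2) x k := by
    intro k hk
    have hk' := mem_range.1 hk
    exact_mod_cast LK3_termwise (m + 2) (by omega) x hx k (by omega)
  have hs := sum_congr rfl ht
  rw [sum_range_sub (fun k => gL (m + 2) x k), gL_zero, sub_zero] at hs
  rw [← hs]; simp only [sum_add_distrib, mul_sum]

/-- Value of a tabulated endpoint symbol with prescribed (ring-equal) argument forms. -/
theorem TvP_val {tab : List (ℤ × ℤ × ℤ × ℤ)} {n : ℕ} {x : ℚ} {s : ℕ} {j₁ l₁ j₂ l₂ : ℤ}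
    (h : tab[s]? = some (j₁, l₁, j₂, l₂)) (a b c d : ℚ) (ha : a = 2 * (n : ℚ) - x + 1 + j₁)
    (hb : b = 3 * (n : ℚ) - x + l₁) (hc : c = 2 * (n : ℚ) - x + 1 + j₂) (hd : d = (n : ℚ) + 1 + l₂) :
    TvP tab n x s = T n a b * T n c d := by
  subst ha hb hc hd; simpa using TvP_of_eq h

set_option maxHeartbeats 8000000 in
set_option maxRecDepth 50000 in
/-- **The boundary term of (L-K3) vanishes** (`n = m+2 ≥ 2`, `x ∉ ℤ`):
`Σ_j η_j·[sL(n,x+j,n−1) + sL(n,x+j,n)] + gL(n,x,n−1) = 0`. -/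
theorem LK3_boundary (m : ℕ) (x : ℚ) (hx : ∀ z : ℤ, x ≠ z) :
    ev2 etaL0 (m + 2) x * (sL (m + 2) x (m + 1) + sL (m + 2) x (m + 2))
      + ev2 etaL1 (m + 2) x * (sL (m + 2) (x + 1) (m + 1) + sL (m + 2) (x + 1) (m + 2))
      + ev2 etaL2 (m + 2) x * (sL (m + 2) (x + 2) (m + 1) + sL (m + 2) (x + 2) (m + 2))
      + ev2 etaL3 (m + 2) x * (sL (m + 2) (x + 3) (m + 1) + sL (m + 2) (x + 3) (m + 2))
      + gL (m + 2) x (m + 1) = 0 := by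
  have hE := EEnd_eval_zero (m + 2) (by omega) x hx
  simp only [EEnd, lcEval_lcAdd, lcEval_lcSingle, zero_add, ev3_mul3, ev3_neg3, ev3_cons, ev3_nil, mul_zero, add_zero,
    ev3_lin3] at hE
  have hX0 : TvP tabP (m + 2) x 0 = T (m + 2) (3 * ((m + 2 : ℕ) : ℚ) - x - ((m + 1 : ℕ) : ℚ)) (3 * ((m + 2 : ℕ) : ℚ) - x) * T (m + 2) (3 * ((m + 2 : ℕ) : ℚ) - x - ((m + 1 : ℕ) : ℚ)) (2 * ((m + 2 : ℕ) : ℚ) - ((m + 1 : ℕ) : ℚ)) :=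
    TvP_val (show tabP[0]? = some (0, 0, 0, 0) by rfl) _ _ _ _ (by push_cast; ring) (by push_cast; ring)
      (by push_cast; ring) (by push_cast; ring)
  have hX2 : TvP tabP (m + 2) x 2 = T (m + 2) (3 * ((m + 2 : ℕ) : ℚ) - (x + 1) - ((m + 1 : ℕ) : ℚ)) (3 * ((m + 2 : ℕ) : ℚ) - (x + 1)) * T (m + 2) (3 * ((m + 2 : ℕ) : ℚ) - (x + 1) - ((m + 1 : ℕ) : ℚ)) (2 * ((m + 2 : ℕ) : ℚ) - ((m + 1 : ℕ) : ℚ)) :=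
    TvP_val (show tabP[2]? = some (-1, -1, -1, 0) by rfl) _ _ _ _ (by push_cast; ring) (by push_cast; ring)
      (by push_cast; ring) (by push_cast; ring)
  have hX4 : TvP tabP (m + 2) x 4 = T (m + 2) (3 * ((m + 2 : ℕ) : ℚ) - (x + 2) - ((m + 1 : ℕ) : ℚ)) (3 * ((m + 2 : ℕ) : ℚ) - (x + 2)) * T (m + 2) (3 * ((m + 2 : ℕ) : ℚ) - (x + 2) - ((m + 1 : ℕ) : ℚ)) (2 * ((m + 2 : ℕ) : ℚ) - ((m + 1 : ℕ) : ℚ)) :=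
    TvP_val (show tabP[4]? = some (-2, -2, -2, 0) by rfl) _ _ _ _ (by push_cast; ring) (by push_cast; ring)
      (by push_cast; ring) (by push_cast; ring)
  have hX6 : TvP tabP (m + 2) x 6 = T (m + 2) (3 * ((m + 2 : ℕ) : ℚ) - (x + 3) - ((m + 1 : ℕ) : ℚ)) (3 * ((m + 2 : ℕ) : ℚ) - (x + 3)) * T (m + 2) (3 * ((m + 2 : ℕ) : ℚ) - (x + 3) - ((m + 1 : ℕ) : ℚ)) (2 * ((m + 2 : ℕ) : ℚ) - ((m + 1 : ℕ) : ℚ)) :=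
    TvP_val (show tabP[6]? = some (-3, -3, -3, 0) by rfl) _ _ _ _ (by push_cast; ring) (by push_cast; ring)
      (by push_cast; ring) (by push_cast; ring)
  have hX1 : TvP tabP (m + 2) x 1 = T (m + 2) (3 * ((m + 2 : ℕ) : ℚ) - x - ((m + 2 : ℕ) : ℚ)) (3 * ((m + 2 : ℕ) : ℚ) - x) * T (m + 2) (3 * ((m + 2 : ℕ) : ℚ) - x - ((m + 2 : ℕ) : ℚ)) (2 * ((m + 2 : ℕ) : ℚ) - ((m + 2 : ℕ) : ℚ)) :=
    TvP_val (show tabP[1]? = some (-1, 0, -1, -1) by rfl) _ _ _ _ (by push_cast; ring) (by push_cast; ring)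
      (by push_cast; ring) (by push_cast; ring)
  have hX3 : TvP tabP (m + 2) x 3 = T (m + 2) (3 * ((m + 2 : ℕ) : ℚ) - (x + 1) - ((m + 2 : ℕ) : ℚ)) (3 * ((m + 2 : ℕ) : ℚ) - (x + 1)) * T (m + 2) (3 * ((m + 2 : ℕ) : ℚ) - (x + 1) - ((m + 2 : ℕ) : ℚ)) (2 * ((m + 2 : ℕ) : ℚ) - ((m + 2 : ℕ) : ℚ)) :=
    TvP_val (show tabP[3]? = some (-2, -1, -2, -1) by rfl) _ _ _ _ (by push_cast; ring) (by push_cast; ring)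
      (by push_cast; ring) (by push_cast; ring)
  have hX5 : TvP tabP (m + 2) x 5 = T (m + 2) (3 * ((m + 2 : ℕ) : ℚ) - (x + 2) - ((m + 2 : ℕ) : ℚ)) (3 * ((m + 2 : ℕ) : ℚ) - (x + 2)) * T (m + 2) (3 * ((m + 2 : ℕ) : ℚ) - (x + 2) - ((m + 2 : ℕ) : ℚ)) (2 * ((m + 2 : ℕ) : ℚ) - ((m + 2 : ℕ) : ℚ)) :=
    TvP_val (show tabP[5]? = some (-3, -2, -3, -1) by rfl) _ _ _ _ (by push_cast; ring) (by push_cast; ring)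
      (by push_cast; ring) (by push_cast; ring)
  have hX7 : TvP tabP (m + 2) x 7 = T (m + 2) (3 * ((m + 2 : ℕ) : ℚ) - (x + 3) - ((m + 2 : ℕ) : ℚ)) (3 * ((m + 2 : ℕ) : ℚ) - (x + 3)) * T (m + 2) (3 * ((m + 2 : ℕ) : ℚ) - (x + 3) - ((m + 2 : ℕ) : ℚ)) (2 * ((m + 2 : ℕ) : ℚ) - ((m + 2 : ℕ) : ℚ)) :=
    TvP_val (show tabP[7]? = some (-4, -3, -4, -1) by rfl) _ _ _ _ (by push_cast; ring) (by push_cast; ring)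
      (by push_cast; ring) (by push_cast; ring)
  have hX8 : TvP tabP (m + 2) x 8 = T (m + 2) (3 * ((m + 2 : ℕ) : ℚ) - x - ((m + 1 : ℕ) : ℚ)) (3 * ((m + 2 : ℕ) : ℚ) - x) * T (m + 2) (3 * ((m + 2 : ℕ) : ℚ) - x - ((m + 1 : ℕ) : ℚ) + 1) (2 * ((m + 2 : ℕ) : ℚ) - ((m + 1 : ℕ) : ℚ)) :=
    TvP_val (show tabP[8]? = some (0, 0, 1, 0) by rfl) _ _ _ _ (by push_cast; ring) (by push_cast; ring)
      (by push_cast; ring) (by push_cast; ring)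
  have hX9 : TvP tabP (m + 2) x 9 = T (m + 2) (3 * ((m + 2 : ℕ) : ℚ) - x - ((m + 1 : ℕ) : ℚ) + 1) (3 * ((m + 2 : ℕ) : ℚ) - x) * T (m + 2) (3 * ((m + 2 : ℕ) : ℚ) - x - ((m + 1 : ℕ) : ℚ)) (2 * ((m + 2 : ℕ) : ℚ) - ((m + 1 : ℕ) : ℚ)) :=
    TvP_val (show tabP[9]? = some (1, 0, 0, 0) by rfl) _ _ _ _ (by push_cast; ring) (by push_cast; ring)
      (by push_cast; ring) (by push_cast; ring)
  have hX10 : TvP tabP (m + 2) x 10 = T (m + 2) (3 * ((m + 2 : ℕ) : ℚ) - x - ((m + 1 : ℕ) : ℚ) + 1) (3 * ((m + 2 : ℕ) : ℚ) - x) * T (m + 2) (3 * ((m + 2 : ℕ) : ℚ) - x - ((m + 1 : ℕ) : ℚ) + 1) (2 * ((m + 2 : ℕ) : ℚ) - ((m + 1 : ℕ) : ℚ)) :=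
    TvP_val (show tabP[10]? = some (1, 0, 1, 0) by rfl) _ _ _ _ (by push_cast; ring) (by push_cast; ring)
      (by push_cast; ring) (by push_cast; ring)
  rw [hX0, hX2, hX4, hX6, hX1, hX3, hX5, hX7, hX8, hX9, hX10, PsiL00E_eq, PsiL01E_eq, PsiL10E_eq, PsiL11E_eq] at hE
  have hc1 : (((m + 2).choose (m + 1) : ℕ) : ℚ) = (m : ℚ) + 2 := by
    rw [show m + 2 = (m + 1) + 1 by ring, Nat.choose_succ_self_right]; push_cast; ring
  have hc2 : (((m + 2).choose (m + 2) : ℕ) : ℚ) = 1 := by rw [Nat.choose_self]; simp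
  have hpow : ((-1 : ℚ)) ^ (m + 2) = -((-1 : ℚ) ^ (m + 1)) := by rw [pow_succ]; ring
  have e1_0 : sL (m + 2) x (m + 1) = (-1) ^ (m + 1) * ((m : ℚ) + 2) * (T (m + 2) (3 * ((m + 2 : ℕ) : ℚ) - x - ((m + 1 : ℕ) : ℚ)) (3 * ((m + 2 : ℕ) : ℚ) - x) * T (m + 2) (3 * ((m + 2 : ℕ) : ℚ) - x - ((m + 1 : ℕ) : ℚ)) (2 * ((m + 2 : ℕ) : ℚ) - ((m + 1 : ℕ) : ℚ))) := by
    rw [sL, hc1]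
  have e2_0 : sL (m + 2) x (m + 2) = -((-1 : ℚ) ^ (m + 1)) * (T (m + 2) (3 * ((m + 2 : ℕ) : ℚ) - x - ((m + 2 : ℕ) : ℚ)) (3 * ((m + 2 : ℕ) : ℚ) - x) * T (m + 2) (3 * ((m + 2 : ℕ) : ℚ) - x - ((m + 2 : ℕ) : ℚ)) (2 * ((m + 2 : ℕ) : ℚ) - ((m + 2 : ℕ) : ℚ))) := by
    rw [sL, hc2, hpow, mul_one]
  have e1_1 : sL (m + 2) (x + 1) (m + 1) = (-1) ^ (m + 1) * ((m : ℚ) + 2) * (T (m + 2) (3 * ((m + 2 : ℕ) : ℚ) - (x + 1) - ((m + 1 : ℕ) : ℚ)) (3 * ((m + 2 : ℕ) : ℚ) - (x + 1)) * T (m + 2) (3 * ((m + 2 : ℕ) : ℚ) - (x + 1) - ((m + 1 : ℕ) : ℚ)) (2 * ((m + 2 : ℕ) : ℚ) - ((m + 1 : ℕ) : ℚ))) := by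
    rw [sL, hc1]
  have e2_1 : sL (m + 2) (x + 1) (m + 2) = -((-1 : ℚ) ^ (m + 1)) * (T (m + 2) (3 * ((m + 2 : ℕ) : ℚ) - (x + 1) - ((m + 2 : ℕ) : ℚ)) (3 * ((m + 2 : ℕ) : ℚ) - (x + 1)) * T (m + 2) (3 * ((m + 2 : ℕ) : ℚ) - (x + 1) - ((m + 2 : ℕ) : ℚ)) (2 * ((m + 2 : ℕ) : ℚ) - ((m + 2 : ℕ) : ℚ))) := by
    rw [sL, hc2, hpow, mul_one]
  have e1_2 : sL (m + 2) (x + 2) (m + 1) = (-1) ^ (m + 1) * ((m : ℚ) + 2) * (T (m + 2) (3 * ((m + 2 : ℕ) : ℚ) - (x + 2) - ((m + 1 : ℕ) : ℚ)) (3 * ((m + 2 : ℕ) : ℚ) - (x + 2)) * T (m + 2) (3 * ((m + 2 : ℕ) : ℚ) - (x + 2) - ((m + 1 : ℕ) : ℚ)) (2 * ((m + 2 : ℕ) : ℚ) - ((m + 1 : ℕ) : ℚ))) := by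
    rw [sL, hc1]
  have e2_2 : sL (m + 2) (x + 2) (m + 2) = -((-1 : ℚ) ^ (m + 1)) * (T (m + 2) (3 * ((m + 2 : ℕ) : ℚ) - (x + 2) - ((m + 2 : ℕ) : ℚ)) (3 * ((m + 2 : ℕ) : ℚ) - (x + 2)) * T (m + 2) (3 * ((m + 2 : ℕ) : ℚ) - (x + 2) - ((m + 2 : ℕ) : ℚ)) (2 * ((m + 2 : ℕ) : ℚ) - ((m + 2 : ℕ) : ℚ))) := by
    rw [sL, hc2, hpow, mul_one]
  have e1_3 : sL (m + 2) (x + 3) (m + 1) = (-1) ^ (m + 1) * ((m : ℚ) + 2) * (T (m + 2) (3 * ((m + 2 : ℕ) : ℚ) - (x + 3) - ((m + 1 : ℕ) : ℚ)) (3 * ((m + 2 : ℕ) : ℚ) - (x + 3)) * T (m + 2) (3 * ((m + 2 : ℕ) : ℚ) - (x + 3) - ((m + 1 : ℕ) : ℚ)) (2 * ((m + 2 : ℕ) : ℚ) - ((m + 1 : ℕ) : ℚ))) := by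
    rw [sL, hc1]
  have e2_3 : sL (m + 2) (x + 3) (m + 2) = -((-1 : ℚ) ^ (m + 1)) * (T (m + 2) (3 * ((m + 2 : ℕ) : ℚ) - (x + 3) - ((m + 2 : ℕ) : ℚ)) (3 * ((m + 2 : ℕ) : ℚ) - (x + 3)) * T (m + 2) (3 * ((m + 2 : ℕ) : ℚ) - (x + 3) - ((m + 2 : ℕ) : ℚ)) (2 * ((m + 2 : ℕ) : ℚ) - ((m + 2 : ℕ) : ℚ))) := by
    rw [sL, hc2, hpow, mul_one]
  have hd : ddenL (m + 2) x (m + 1) ≠ 0 := by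
    have h3 : x + ((m + 1 : ℕ) : ℚ) - 2 * ((m + 2 : ℕ) : ℚ) ≠ 0 := fun h => hx (m + 3) (by push_cast at h ⊢; linarith)
    have h4 : x + ((m + 1 : ℕ) : ℚ) - 2 * ((m + 2 : ℕ) : ℚ) + 1 ≠ 0 := fun h => hx (m + 2) (by push_cast at h ⊢; linarith)
    have h5 : x + ((m + 1 : ℕ) : ℚ) - 2 * ((m + 2 : ℕ) : ℚ) + 2 ≠ 0 := fun h => hx (m + 1) (by push_cast at h ⊢; linarith)
    have h1 : ((m + 1 : ℕ) : ℚ) + 1 ≠ 0 := by positivity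
    have h2 : ((m + 2 : ℕ) : ℚ) - ((m + 1 : ℕ) : ℚ) ≠ 0 := by push_cast; intro h; linarith
    unfold ddenL
    exact mul_ne_zero (mul_ne_zero h1 h2) (mul_ne_zero (mul_ne_zero (pow_ne_zero _ h3) (pow_ne_zero _ h4)) (pow_ne_zero _ h5))
  have hg : ddenL (m + 2) x (m + 1) * gL (m + 2) x (m + 1) = (-1) ^ (m + 1) * ((m : ℚ) + 2) * SL (m + 2) x (m + 1) := by
    rw [gL, hc1]; field_simp
  have eS : SL (m + 2) x (m + 1) = ev3 PsiL00 (m + 2 : ℕ) x (m + 1 : ℕ) * (T (m + 2) (3 * ((m + 2 : ℕ) : ℚ) - x - ((m + 1 : ℕ) : ℚ)) (3 * ((m + 2 : ℕ) : ℚ) - x) * T (m + 2) (3 * ((m + 2 : ℕ) : ℚ) - x - ((m + 1 : ℕ) : ℚ)) (2 * ((m + 2 : ℕ) : ℚ) - ((m + 1 : ℕ) : ℚ)))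
      + ev3 PsiL01 (m + 2 : ℕ) x (m + 1 : ℕ) * (T (m + 2) (3 * ((m + 2 : ℕ) : ℚ) - x - ((m + 1 : ℕ) : ℚ)) (3 * ((m + 2 : ℕ) : ℚ) - x) * T (m + 2) (3 * ((m + 2 : ℕ) : ℚ) - x - ((m + 1 : ℕ) : ℚ) + 1) (2 * ((m + 2 : ℕ) : ℚ) - ((m + 1 : ℕ) : ℚ)))
      + ev3 PsiL10 (m + 2 : ℕ) x (m + 1 : ℕ) * (T (m + 2) (3 * ((m + 2 : ℕ) : ℚ) - x - ((m + 1 : ℕ) : ℚ) + 1) (3 * ((m + 2 : ℕ) : ℚ) - x) * T (m + 2) (3 * ((m + 2 : ℕ) : ℚ) - x - ((m + 1 : ℕ) : ℚ)) (2 * ((m + 2 : ℕ) : ℚ) - ((m + 1 : ℕ) : ℚ)))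
      + ev3 PsiL11 (m + 2 : ℕ) x (m + 1 : ℕ) * (T (m + 2) (3 * ((m + 2 : ℕ) : ℚ) - x - ((m + 1 : ℕ) : ℚ) + 1) (3 * ((m + 2 : ℕ) : ℚ) - x) * T (m + 2) (3 * ((m + 2 : ℕ) : ℚ) - x - ((m + 1 : ℕ) : ℚ) + 1) (2 * ((m + 2 : ℕ) : ℚ) - ((m + 1 : ℕ) : ℚ))) := rfl
  have ed : ddenL (m + 2) x (m + 1) = (((m + 1 : ℕ) : ℚ) + 1) * (((m + 2 : ℕ) : ℚ) - ((m + 1 : ℕ) : ℚ)) *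
      ((x + ((m + 1 : ℕ) : ℚ) - 2 * ((m + 2 : ℕ) : ℚ)) ^ 2 * (x + ((m + 1 : ℕ) : ℚ) - 2 * ((m + 2 : ℕ) : ℚ) + 1) ^ 2 *
        (x + ((m + 1 : ℕ) : ℚ) - 2 * ((m + 2 : ℕ) : ℚ) + 2) ^ 2) := rfl
  rw [eS, ed] at hg
  -- the Ψ data at k = n−1: `ev3 PsiL·· n x (n−1)` vs `ev3 PsiL·· n x (n - 1)` from `PsiL··E_eq`
  have ek : (((m + 2 : ℕ) : ℚ)) - 1 = ((m + 1 : ℕ) : ℚ) := by push_cast; ring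
  rw [ek] at hE
  -- cancel the non-zero clearing factor n·dd'
  have hM : ((m + 2 : ℕ) : ℚ) * ((x - ((m + 2 : ℕ) : ℚ) - 1) ^ 2 * (x - ((m + 2 : ℕ) : ℚ)) ^ 2 * (x - ((m + 2 : ℕ) : ℚ) + 1) ^ 2) ≠ 0 := by
    have h0 : ((m + 2 : ℕ) : ℚ) ≠ 0 := by positivity
    have h3 : x - ((m + 2 : ℕ) : ℚ) - 1 ≠ 0 := fun h => hx (m + 3) (by push_cast at h ⊢; linarith)
    have h4 : x - ((m + 2 : ℕ) : ℚ) ≠ 0 := fun h => hx (m + 2) (by push_cast at h ⊢; linarith)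
    have h5 : x - ((m + 2 : ℕ) : ℚ) + 1 ≠ 0 := fun h => hx (m + 1) (by push_cast at h ⊢; linarith)
    exact mul_ne_zero h0 (mul_ne_zero (mul_ne_zero (pow_ne_zero _ h3) (pow_ne_zero _ h4)) (pow_ne_zero _ h5))
  refine mul_left_cancel₀ hM ?_
  rw [e1_0, e1_1, e1_2, e1_3, e2_0, e2_1, e2_2, e2_3, mul_zero]
  push_cast at hE hg ⊢
  linear_combination ((-1 : ℚ) ^ (m + 1) * ((m : ℚ) + 2)) * hE + hg

/-- **(L-K3)** (cert-2, kernel module reduction): for `n ≥ 2` and non-integral rational `x`,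
`η₀(n,x)·L(n,x) + η₁(n,x)·L(n,x+1) + η₂(n,x)·L(n,x+2) + η₃(n,x)·L(n,x+3) = 0` — the ttrl2 lane's pure `k₃`-shift relation of
the triple sum of fam-brown9's leading coefficient (`η_j = ev2 etaLj`, integer data; `η₀ = −(x+1)(x−2n)⁵`). -/
theorem L_rel_K3 (n : ℕ) (hn : 2 ≤ n) (x : ℚ) (hx : ∀ z : ℤ, x ≠ z) :
    ev2 etaL0 n x * Lsum n x + ev2 etaL1 n x * Lsum n (x + 1) + ev2 etaL2 n x * Lsum n (x + 2)
      + ev2 etaL3 n x * Lsum n (x + 3) = 0 := by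
  obtain ⟨m, rfl⟩ : ∃ m, n = m + 2 := ⟨n - 2, by omega⟩
  have ht := LK3_telescoped m x hx
  have hb := LK3_boundary m x hx
  have hs : ∀ y : ℚ, Lsum (m + 2) y = ∑ k ∈ range (m + 1), sL (m + 2) y k + (sL (m + 2) y (m + 1) + sL (m + 2) y (m + 2)) := by
    intro y; rw [Lsum, sum_range_succ, sum_range_succ]; ring
  rw [hs, hs, hs, hs]
  push_cast at ht hb ⊢
  linear_combination ht + hb

end VIMInner.ModRed

end Summit.KontsevichZagierPeriods.Zeta5Search.Certificates
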